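import Mathlib
import Literature.Probability.RandomPlanarGeometry.HexSAW

/-!
# Component extraction at a vertex for even subgraphs

Route `SAWMassiveIsingTilt` of `CriticalPhenomena/SAWScalingLimit`; line `registered` of the crux
`CriticalCurveContinuity` (stmt-CriticalPhenomena-7686), cycle 3, sub-goal S-A. The loop-gas
partition function sums a weight `f E` over the *even* edge sets `E ⊆ EH` supported inside a vertex
set `T` (`E.biUnion Sym2.toFinset ⊆ T`, every vertex has even `E`-degree). Fixing a vertex `v`,
such an `E` either avoids `v` (it is then supported in `T.erase v`) or splits UNIQUELY as
`E = E₁ ⊔ E₂` with `E₁` the connected component of `E` through `v` — an even, connected edge set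
containing `v` in its support — and `E₂ = E ∖ E₁` an even edge set supported in `T` off the
support of `E₁` (`evenSubgraph_sum_split`). This is the combinatorial input making the loop gas a
subset-polymer gas whose polymers are the supports of connected even subgraphs.

The component of `E` through `v` is written throughout as the explicit filter
`E.filter fun e => ∃ w ∈ e, (SimpleGraph.fromEdgeSet ↑E).Reachable v w` (no definitions).
-/

noncomputable section

open Literature.Probability Literature.Probability.LatticeModels
  Literature.Probability.RandomPlanarGeometry
open scoped Classical

namespace Summit.CriticalPhenomena.SAWScalingLimit.Theorems.SAWMassiveIsingTilt

variable {α : Type*}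

/-- Walk transfer with an invariant: if from every vertex satisfying `P` each `H₁`-edge is an
`H₂`-edge leading again into `P`, then `H₁`-reachability from a `P`-vertex gives
`H₂`-reachability, and the endpoint satisfies `P`. -/
theorem evenSplit_reachable_transfer {H₁ H₂ : SimpleGraph α} {P : α → Prop}
    (hP : ∀ u w, P u → H₁.Adj u w → H₂.Adj u w ∧ P w) {x y : α} (hx : P x)
    (h : H₁.Reachable x y) : H₂.Reachable x y ∧ P y := by
  suffices key : ∀ (u w : α) (_ : H₁.Walk u w), P u → H₂.Reachable x u →
      H₂.Reachable x w ∧ P w by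
    obtain ⟨p⟩ := h
    exact key x y p hx (SimpleGraph.Reachable.refl x)
  intro u w p
  induction p with
  | nil => exact fun hu hxu => ⟨hxu, hu⟩
  | @cons a b c hab p ih =>
    intro ha hxa
    obtain ⟨h2, hb⟩ := hP a b ha hab
    exact ih hb (hxa.trans h2.reachable)

/-- If an edge `e ∈ E` has an endpoint reachable from `v` in the graph spanned by `E`, then every
endpoint of `e` is reachable from `v`. -/
theorem evenSplit_reachable_of_mem_edge {E : Finset (Sym2 α)} {v u u' : α} {e : Sym2 α}
    (he : e ∈ E) (hu : u ∈ e) (hu' : u' ∈ e)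
    (h : (SimpleGraph.fromEdgeSet (E : Set (Sym2 α))).Reachable v u') :
    (SimpleGraph.fromEdgeSet (E : Set (Sym2 α))).Reachable v u := by
  by_cases huu : u' = u
  · subst huu
    exact h
  · refine h.trans (SimpleGraph.Adj.reachable ?_)
    rw [SimpleGraph.fromEdgeSet_adj]
    refine ⟨?_, huu⟩
    rw [← (Sym2.mem_and_mem_iff huu).mp ⟨hu', hu⟩]
    exact Finset.mem_coe.mpr he

/-- At a vertex reachable from `v`, the component of `E` through `v` has the same edges as `E`. -/
theorem evenSplit_component_filter_mem_of_reachable [DecidableEq α] (E : Finset (Sym2 α))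
    {v u : α} (hu : (SimpleGraph.fromEdgeSet (E : Set (Sym2 α))).Reachable v u) :
    (E.filter fun e => ∃ w ∈ e, (SimpleGraph.fromEdgeSet (E : Set (Sym2 α))).Reachable v w).filter
        (fun e => u ∈ e) = E.filter (fun e => u ∈ e) := by
  ext e
  simp only [Finset.mem_filter]
  exact ⟨fun h => ⟨h.1.1, h.2⟩, fun h => ⟨⟨h.1, u, h.2, hu⟩, h.2⟩⟩

/-- At a vertex not reachable from `v`, the component of `E` through `v` has no edges. -/
theorem evenSplit_component_filter_mem_of_not_reachable [DecidableEq α] (E : Finset (Sym2 α))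
    {v u : α} (hu : ¬(SimpleGraph.fromEdgeSet (E : Set (Sym2 α))).Reachable v u) :
    (E.filter fun e => ∃ w ∈ e, (SimpleGraph.fromEdgeSet (E : Set (Sym2 α))).Reachable v w).filter
        (fun e => u ∈ e) = ∅ := by
  refine Finset.filter_eq_empty_iff.mpr ?_
  intro e he hue
  obtain ⟨he, w, hw, hvw⟩ := Finset.mem_filter.mp he
  exact hu (evenSplit_reachable_of_mem_edge he hue hw hvw)

/-- At a vertex reachable from `v`, the remainder `E ∖ (component through v)` has no edges. -/
theorem evenSplit_sdiff_component_filter_mem_of_reachable [DecidableEq α] (E : Finset (Sym2 α))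
    {v u : α} (hu : (SimpleGraph.fromEdgeSet (E : Set (Sym2 α))).Reachable v u) :
    (E \ E.filter fun e => ∃ w ∈ e,
        (SimpleGraph.fromEdgeSet (E : Set (Sym2 α))).Reachable v w).filter (fun e => u ∈ e) = ∅ := by
  refine Finset.filter_eq_empty_iff.mpr ?_
  intro e he hue
  obtain ⟨heE, heC⟩ := Finset.mem_sdiff.mp he
  exact heC (Finset.mem_filter.mpr ⟨heE, u, hue, hu⟩)

/-- At a vertex not reachable from `v`, the remainder `E ∖ (component through v)` has the same
edges as `E`. -/
theorem evenSplit_sdiff_component_filter_mem_of_not_reachable [DecidableEq α]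
    (E : Finset (Sym2 α)) {v u : α}
    (hu : ¬(SimpleGraph.fromEdgeSet (E : Set (Sym2 α))).Reachable v u) :
    (E \ E.filter fun e => ∃ w ∈ e,
        (SimpleGraph.fromEdgeSet (E : Set (Sym2 α))).Reachable v w).filter (fun e => u ∈ e) =
      E.filter (fun e => u ∈ e) := by
  ext e
  simp only [Finset.mem_filter, Finset.mem_sdiff]
  refine ⟨fun h => ⟨h.1.1, h.2⟩, fun h => ⟨⟨h.1, fun hC => hu ?_⟩, h.2⟩⟩
  obtain ⟨_, w, hw, hvw⟩ := hC
  exact evenSplit_reachable_of_mem_edge h.1 h.2 hw hvw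

/-- The component through `v` of an even edge set is even. -/
theorem evenSplit_component_even [DecidableEq α] {E : Finset (Sym2 α)} (v : α)
    (hE : ∀ u : α, Even (E.filter fun e => u ∈ e).card) (u : α) :
    Even ((E.filter fun e => ∃ w ∈ e,
      (SimpleGraph.fromEdgeSet (E : Set (Sym2 α))).Reachable v w).filter (fun e => u ∈ e)).card := by
  by_cases hu : (SimpleGraph.fromEdgeSet (E : Set (Sym2 α))).Reachable v u
  · rw [evenSplit_component_filter_mem_of_reachable E hu]
    exact hE u
  · rw [evenSplit_component_filter_mem_of_not_reachable E hu, Finset.card_empty]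
    exact ⟨0, rfl⟩

/-- The remainder `E ∖ (component through v)` of an even edge set is even. -/
theorem evenSplit_sdiff_component_even [DecidableEq α] {E : Finset (Sym2 α)} (v : α)
    (hE : ∀ u : α, Even (E.filter fun e => u ∈ e).card) (u : α) :
    Even ((E \ E.filter fun e => ∃ w ∈ e,
      (SimpleGraph.fromEdgeSet (E : Set (Sym2 α))).Reachable v w).filter (fun e => u ∈ e)).card := by
  by_cases hu : (SimpleGraph.fromEdgeSet (E : Set (Sym2 α))).Reachable v u
  · rw [evenSplit_sdiff_component_filter_mem_of_reachable E hu, Finset.card_empty]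
    exact ⟨0, rfl⟩
  · rw [evenSplit_sdiff_component_filter_mem_of_not_reachable E hu]
    exact hE u

/-- Vertices on an edge of the component through `v` are reachable from `v`. -/
theorem evenSplit_reachable_of_mem_supp_component [DecidableEq α] {E : Finset (Sym2 α)}
    {v u : α}
    (hu : u ∈ (E.filter fun e => ∃ w ∈ e,
      (SimpleGraph.fromEdgeSet (E : Set (Sym2 α))).Reachable v w).biUnion Sym2.toFinset) :
    (SimpleGraph.fromEdgeSet (E : Set (Sym2 α))).Reachable v u := by
  obtain ⟨e, he, hue⟩ := Finset.mem_biUnion.mp hu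
  obtain ⟨he, w, hw, hvw⟩ := Finset.mem_filter.mp he
  exact evenSplit_reachable_of_mem_edge he (Sym2.mem_toFinset.mp hue) hw hvw

/-- `v` lies on the support of its own component as soon as it lies on the support of `E`. -/
theorem evenSplit_mem_supp_component [DecidableEq α] {E : Finset (Sym2 α)} {v : α}
    (hv : v ∈ E.biUnion Sym2.toFinset) :
    v ∈ (E.filter fun e => ∃ w ∈ e,
      (SimpleGraph.fromEdgeSet (E : Set (Sym2 α))).Reachable v w).biUnion Sym2.toFinset := by
  obtain ⟨e, he, hve⟩ := Finset.mem_biUnion.mp hv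
  exact Finset.mem_biUnion.mpr ⟨e, Finset.mem_filter.mpr
    ⟨he, v, Sym2.mem_toFinset.mp hve, SimpleGraph.Reachable.refl v⟩, hve⟩

/-- The support of the component through `v` lies in the support of `E`. -/
theorem evenSplit_supp_component_subset [DecidableEq α] (E : Finset (Sym2 α)) (v : α) :
    (E.filter fun e => ∃ w ∈ e,
        (SimpleGraph.fromEdgeSet (E : Set (Sym2 α))).Reachable v w).biUnion Sym2.toFinset ⊆
      E.biUnion Sym2.toFinset :=
  Finset.biUnion_subset_biUnion_of_subset_left _ (Finset.filter_subset _ _)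

/-- The support of the remainder `E ∖ (component through v)` lies in `T` and avoids the support of
the component, as soon as `E` is supported in `T`. -/
theorem evenSplit_supp_sdiff_component_subset [DecidableEq α] {E : Finset (Sym2 α)} {v : α}
    {T : Finset α} (hT : E.biUnion Sym2.toFinset ⊆ T) :
    (E \ E.filter fun e => ∃ w ∈ e,
        (SimpleGraph.fromEdgeSet (E : Set (Sym2 α))).Reachable v w).biUnion Sym2.toFinset ⊆
      T \ (E.filter fun e => ∃ w ∈ e,
        (SimpleGraph.fromEdgeSet (E : Set (Sym2 α))).Reachable v w).biUnion Sym2.toFinset := by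
  intro u hu
  obtain ⟨e, he, hue⟩ := Finset.mem_biUnion.mp hu
  obtain ⟨heE, heC⟩ := Finset.mem_sdiff.mp he
  refine Finset.mem_sdiff.mpr ⟨hT (Finset.mem_biUnion.mpr ⟨e, heE, hue⟩), fun huC => heC ?_⟩
  exact Finset.mem_filter.mpr
    ⟨heE, u, Sym2.mem_toFinset.mp hue, evenSplit_reachable_of_mem_supp_component huC⟩

/-- The component through `v` is connected on its support (inside its own edge graph). -/
theorem evenSplit_component_reachable [DecidableEq α] {E : Finset (Sym2 α)} {v u w : α}
    (hu : u ∈ (E.filter fun e => ∃ w ∈ e,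
      (SimpleGraph.fromEdgeSet (E : Set (Sym2 α))).Reachable v w).biUnion Sym2.toFinset)
    (hw : w ∈ (E.filter fun e => ∃ w ∈ e,
      (SimpleGraph.fromEdgeSet (E : Set (Sym2 α))).Reachable v w).biUnion Sym2.toFinset) :
    (SimpleGraph.fromEdgeSet (((E.filter fun e => ∃ w ∈ e,
      (SimpleGraph.fromEdgeSet (E : Set (Sym2 α))).Reachable v w) : Finset (Sym2 α)) :
        Set (Sym2 α))).Reachable u w := by
  have key : ∀ x, (SimpleGraph.fromEdgeSet (E : Set (Sym2 α))).Reachable v x →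
      (SimpleGraph.fromEdgeSet (((E.filter fun e => ∃ w ∈ e,
        (SimpleGraph.fromEdgeSet (E : Set (Sym2 α))).Reachable v w) : Finset (Sym2 α)) :
          Set (Sym2 α))).Reachable v x := by
    intro x hx
    refine (evenSplit_reachable_transfer
      (H₁ := SimpleGraph.fromEdgeSet (E : Set (Sym2 α)))
      (P := fun y => (SimpleGraph.fromEdgeSet (E : Set (Sym2 α))).Reachable v y)
      ?_ (SimpleGraph.Reachable.refl v) hx).1
    intro a b ha hab
    have hab' := (SimpleGraph.fromEdgeSet_adj _).mp hab
    refine ⟨?_, ha.trans hab.reachable⟩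
    rw [SimpleGraph.fromEdgeSet_adj]
    refine ⟨?_, hab'.2⟩
    rw [Finset.mem_coe, Finset.mem_filter]
    exact ⟨Finset.mem_coe.mp hab'.1, a, Sym2.mem_mk_left a b, ha⟩
  exact (key u (evenSplit_reachable_of_mem_supp_component hu)).symm.trans
    (key w (evenSplit_reachable_of_mem_supp_component hw))

/-- Two edge sets with disjoint supports are disjoint. -/
theorem evenSplit_disjoint [DecidableEq α] {E₁ E₂ : Finset (Sym2 α)}
    (h : ∀ u ∈ E₂.biUnion Sym2.toFinset, u ∉ E₁.biUnion Sym2.toFinset) : Disjoint E₁ E₂ := by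
  rw [Finset.disjoint_left]
  intro e he1 he2
  exact h _ (Finset.mem_biUnion.mpr ⟨e, he2, Sym2.mem_toFinset.mpr (Sym2.out_fst_mem e)⟩)
    (Finset.mem_biUnion.mpr ⟨e, he1, Sym2.mem_toFinset.mpr (Sym2.out_fst_mem e)⟩)

/-- Degrees add over a disjoint union: the union of two disjoint even edge sets is even. -/
theorem evenSplit_union_even [DecidableEq α] {E₁ E₂ : Finset (Sym2 α)} (hd : Disjoint E₁ E₂)
    (h1 : ∀ u : α, Even (E₁.filter fun e => u ∈ e).card)
    (h2 : ∀ u : α, Even (E₂.filter fun e => u ∈ e).card) (u : α) :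
    Even ((E₁ ∪ E₂).filter fun e => u ∈ e).card := by
  rw [Finset.filter_union, Finset.card_union_of_disjoint (Finset.disjoint_filter_filter hd)]
  exact (h1 u).add (h2 u)

/-- The support of a union lies in `T` when both supports do. -/
theorem evenSplit_supp_union_subset [DecidableEq α] {E₁ E₂ : Finset (Sym2 α)} {T : Finset α}
    (h1 : E₁.biUnion Sym2.toFinset ⊆ T) (h2 : E₂.biUnion Sym2.toFinset ⊆ T) :
    (E₁ ∪ E₂).biUnion Sym2.toFinset ⊆ T := by
  intro u hu
  obtain ⟨e, he, hue⟩ := Finset.mem_biUnion.mp hu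
  rcases Finset.mem_union.mp he with he | he
  · exact h1 (Finset.mem_biUnion.mpr ⟨e, he, hue⟩)
  · exact h2 (Finset.mem_biUnion.mpr ⟨e, he, hue⟩)

/-- If `E₁` contains `v` in its support and the support of `E₂` avoids that of `E₁`, then every
vertex reachable from `v` in the graph of `E₁ ∪ E₂` lies in the support of `E₁`. -/
theorem evenSplit_mem_supp_of_reachable_union [DecidableEq α] {E₁ E₂ : Finset (Sym2 α)}
    {v x : α} (h : ∀ u ∈ E₂.biUnion Sym2.toFinset, u ∉ E₁.biUnion Sym2.toFinset)
    (hv : v ∈ E₁.biUnion Sym2.toFinset)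
    (hx : (SimpleGraph.fromEdgeSet ((E₁ ∪ E₂ : Finset (Sym2 α)) : Set (Sym2 α))).Reachable v x) :
    x ∈ E₁.biUnion Sym2.toFinset := by
  refine (evenSplit_reachable_transfer
    (H₂ := SimpleGraph.fromEdgeSet ((E₁ ∪ E₂ : Finset (Sym2 α)) : Set (Sym2 α)))
    (P := fun y => y ∈ E₁.biUnion Sym2.toFinset) ?_ hv hx).2
  intro a b ha hab
  refine ⟨hab, ?_⟩
  have hab' := (SimpleGraph.fromEdgeSet_adj _).mp hab
  rcases Finset.mem_union.mp (Finset.mem_coe.mp hab'.1) with hm | hm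
  · exact Finset.mem_biUnion.mpr ⟨_, hm, Sym2.mem_toFinset.mpr (Sym2.mem_mk_right a b)⟩
  · exact absurd ha
      (h a (Finset.mem_biUnion.mpr ⟨_, hm, Sym2.mem_toFinset.mpr (Sym2.mem_mk_left a b)⟩))

/-- Uniqueness of the splitting: if `E₁` is connected on its support, contains `v` in its support,
and the support of `E₂` avoids that of `E₁`, then the component of `E₁ ∪ E₂` through `v` is
`E₁`. -/
theorem evenSplit_component_union [DecidableEq α] {E₁ E₂ : Finset (Sym2 α)} {v : α}
    (h : ∀ u ∈ E₂.biUnion Sym2.toFinset, u ∉ E₁.biUnion Sym2.toFinset)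
    (hv : v ∈ E₁.biUnion Sym2.toFinset)
    (hconn : ∀ u ∈ E₁.biUnion Sym2.toFinset, ∀ w ∈ E₁.biUnion Sym2.toFinset,
      (SimpleGraph.fromEdgeSet ((E₁ : Finset (Sym2 α)) : Set (Sym2 α))).Reachable u w) :
    ((E₁ ∪ E₂).filter fun e => ∃ w ∈ e,
      (SimpleGraph.fromEdgeSet ((E₁ ∪ E₂ : Finset (Sym2 α)) : Set (Sym2 α))).Reachable v w) =
      E₁ := by
  ext e
  rw [Finset.mem_filter, Finset.mem_union]
  constructor
  · rintro ⟨he, w, hw, hvw⟩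
    have hw1 : w ∈ E₁.biUnion Sym2.toFinset := evenSplit_mem_supp_of_reachable_union h hv hvw
    rcases he with he | he
    · exact he
    · exact absurd hw1 (h w (Finset.mem_biUnion.mpr ⟨e, he, Sym2.mem_toFinset.mpr hw⟩))
  · intro he
    refine ⟨Or.inl he, e.out.1, Sym2.out_fst_mem e, ?_⟩
    have hmono : SimpleGraph.fromEdgeSet ((E₁ : Finset (Sym2 α)) : Set (Sym2 α)) ≤
        SimpleGraph.fromEdgeSet ((E₁ ∪ E₂ : Finset (Sym2 α)) : Set (Sym2 α)) :=
      SimpleGraph.fromEdgeSet_mono (Finset.coe_subset.mpr Finset.subset_union_left)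
    exact (hconn v hv _ (Finset.mem_biUnion.mpr
      ⟨e, he, Sym2.mem_toFinset.mpr (Sym2.out_fst_mem e)⟩)).mono hmono

/-- **Component extraction at a vertex** (S-A of the line `registered`, stmt-7686). Summing a
weight over the even edge sets `E ⊆ EH` supported in `T` splits according to whether `v` lies on
`E`: those avoiding `v` are exactly the even edge sets supported in `T.erase v`; those through `v`
are in bijection `E ↦ (E₁, E₂) = (component of E through v, the rest)` with the pairs consisting of
an even, connected `E₁ ⊆ EH` supported in `T` with `v` on it, and an even `E₂ ⊆ EH` supported in
`T` off the support of `E₁`; the inverse map is `(E₁, E₂) ↦ E₁ ∪ E₂`. -/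
theorem evenSubgraph_sum_split :
    ∀ (EH : Finset (Sym2 HexVertex)) (T : Finset HexVertex) (v : HexVertex)
      (f : Finset (Sym2 HexVertex) → ℂ),
    ∑ E ∈ EH.powerset with (E.biUnion Sym2.toFinset ⊆ T ∧
        ∀ u : HexVertex, Even (E.filter (fun e => u ∈ e)).card), f E =
      ∑ E ∈ EH.powerset with (E.biUnion Sym2.toFinset ⊆ T.erase v ∧
          ∀ u : HexVertex, Even (E.filter (fun e => u ∈ e)).card), f E +
      ∑ E₁ ∈ EH.powerset with (E₁.biUnion Sym2.toFinset ⊆ T ∧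
          (∀ u : HexVertex, Even (E₁.filter (fun e => u ∈ e)).card) ∧
          v ∈ E₁.biUnion Sym2.toFinset ∧
          ∀ u ∈ E₁.biUnion Sym2.toFinset, ∀ w ∈ E₁.biUnion Sym2.toFinset,
            (SimpleGraph.fromEdgeSet ((E₁ : Finset (Sym2 HexVertex)) : Set (Sym2 HexVertex))).Reachable u w),
        ∑ E₂ ∈ EH.powerset with (E₂.biUnion Sym2.toFinset ⊆ T \ E₁.biUnion Sym2.toFinset ∧
            ∀ u : HexVertex, Even (E₂.filter (fun e => u ∈ e)).card), f (E₁ ∪ E₂) := by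
  intro EH T v f
  refine (Finset.sum_filter_not_add_sum_filter _
    (fun E => v ∈ E.biUnion Sym2.toFinset) f).symm.trans ?_
  congr 1
  · -- even edge sets avoiding `v` are those supported in `T.erase v`
    refine Finset.sum_congr ?_ (fun _ _ => rfl)
    ext E
    simp only [Finset.mem_filter, Finset.mem_powerset, Finset.subset_erase]
    tauto
  · -- even edge sets through `v`: fibre over the component through `v`
    symm
    refine (Finset.sum_congr rfl fun E₁ hE₁ => ?_).trans
      (Finset.sum_fiberwise_of_maps_to
        (g := fun E : Finset (Sym2 HexVertex) => E.filter fun e => ∃ w ∈ e,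
          (SimpleGraph.fromEdgeSet (E : Set (Sym2 HexVertex))).Reachable v w) ?_ f)
    · -- the fibre over `E₁` is `{E₁ ∪ E₂}` over the admissible remainders `E₂`
      simp only [Finset.mem_filter, Finset.mem_powerset] at hE₁
      obtain ⟨hE₁H, hT₁, heven₁, hv₁, hconn₁⟩ := hE₁
      symm
      refine Finset.sum_nbij' (fun E => E \ E₁) (fun E₂ => E₁ ∪ E₂) ?_ ?_ ?_ ?_ ?_
      · intro E hE
        simp only [Finset.mem_filter, Finset.mem_powerset] at hE ⊢
        obtain ⟨⟨⟨hEH, hT, heven⟩, _⟩, hC⟩ := hE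
        rw [← hC]
        exact ⟨Finset.sdiff_subset.trans hEH, evenSplit_supp_sdiff_component_subset hT,
          evenSplit_sdiff_component_even v heven⟩
      · intro E₂ hE₂
        simp only [Finset.mem_filter, Finset.mem_powerset] at hE₂ ⊢
        obtain ⟨hE₂H, hT₂, heven₂⟩ := hE₂
        have hdis : ∀ u ∈ E₂.biUnion Sym2.toFinset, u ∉ E₁.biUnion Sym2.toFinset :=
          fun u hu => (Finset.mem_sdiff.mp (hT₂ hu)).2
        exact ⟨⟨⟨Finset.union_subset hE₁H hE₂H,
          evenSplit_supp_union_subset hT₁ (hT₂.trans Finset.sdiff_subset),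
          evenSplit_union_even (evenSplit_disjoint hdis) heven₁ heven₂⟩,
          Finset.biUnion_subset_biUnion_of_subset_left _ Finset.subset_union_left hv₁⟩,
          evenSplit_component_union hdis hv₁ hconn₁⟩
      · intro E hE
        simp only [Finset.mem_filter] at hE
        rw [← hE.2]
        exact Finset.union_sdiff_of_subset (Finset.filter_subset _ _)
      · intro E₂ hE₂
        simp only [Finset.mem_filter, Finset.mem_powerset] at hE₂
        exact Finset.union_sdiff_cancel_left
          (evenSplit_disjoint fun u hu => (Finset.mem_sdiff.mp (hE₂.2.1 hu)).2)
      · intro E hE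
        simp only [Finset.mem_filter] at hE
        congr 1
        rw [← hE.2]
        exact (Finset.union_sdiff_of_subset (Finset.filter_subset _ _)).symm
    · -- the component through `v` of an even edge set through `v` is an admissible `E₁`
      intro E hE
      simp only [Finset.mem_filter, Finset.mem_powerset] at hE ⊢
      obtain ⟨⟨hEH, hT, heven⟩, hv⟩ := hE
      exact ⟨(Finset.filter_subset _ _).trans hEH,
        (evenSplit_supp_component_subset E v).trans hT, evenSplit_component_even v heven,
        evenSplit_mem_supp_component hv, fun u hu w hw => evenSplit_component_reachable hu hw⟩

end Summit.CriticalPhenomena.SAWScalingLimit.Theorems.SAWMassiveIsingTilt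

end
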